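import Mathlib
import HarnessLib
import Summits.HubbardSuperconductivity.HubbardSuperconductivity.Theorems.KLProgrammeKLRegimeEngineV8ExportUnroll
import Summits.HubbardSuperconductivity.HubbardSuperconductivity.Theorems.KLProgrammeKLRegimeEngineV8TwoLegMomentsExport

/-!
# Skeleton v2 of `KLRegimeEngineV17F2` (stmt-HubbardSuperconductivity-20437): unrolling class #7 `TwoLegMomentsStep` (r2d-p1's …TwoLegMomentsExport)
# along the scale ladder — companion of …EngineV8ExportUnroll (cell gate-hubbard-kl, seat p1b g9, registrant lineage)

**`twoLegDualMomentsAt_all_of_step`**: from `TwoLegMomentsStep P R Q₀ Zt Zs u` (binder list VERBATIM `LevelsUStep`'s) and the binders at the package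
`Q₀.withCR r`, the public history `HistP klPredsV17F2 … 0 n` (`n ≤ n_β + 1`) gives the dual-lattice two-leg moment line `TwoLegDualMomentsAt L M Zt Zs β U μ j`
at EVERY `j ≤ n` (strong induction; regime by `isKLRegime_of_le_nScales_succ`, frame admissibility by `frameOK_klFlowFrameU_of_histP`); and
`twoLegDualMomentsAt_klC2_all_of_exists` — the same at the deferred package `(klC2t, klC2s, klC2u)` from the producer's ∃-statement.
Proofs only; no definitions; nothing asserts superconductivity.  References: BGM 2006 §2.4–§3 [cite: BenfattoGiulianiMastropietro2006].
-/

noncomputable section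

namespace Summit.HubbardSuperconductivity.HubbardSuperconductivity.Theorems.EngineV8

set_option linter.dupNamespace false -- summit = problem name (single-conjunct summit), D-0017

open Real Finset Literature.MathematicalPhysics.QuantumLattice Literature.Probability.LatticeModels
open Literature.MathematicalPhysics.QuantumLattice.FermiRG
open Summit.HubbardSuperconductivity.HubbardSuperconductivity.Theorems.KLProgrammeLegKernels
open Summit.HubbardSuperconductivity.HubbardSuperconductivity.Theorems.DispersionFlow
open Summit.HubbardSuperconductivity.HubbardSuperconductivity.Theorems.KLRegimeSplit

variable {P : SplitConsts} {R : RenConsts} {Q₀ : EngConsts} {G : GeoConsts} {r cc μ U β : ℝ} {L M : ℕ} [NeZero L] [NeZero M]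

/-- **CLASS #7 UNROLLED**: from `TwoLegMomentsStep P R Q₀ Zt Zs u` and the binders, the public history up to `n ≤ n_β + 1` gives the dual-lattice two-leg
moment line at EVERY `j ≤ n`. -/
theorem twoLegDualMomentsAt_all_of_step {Zt Zs : ℝ} {u : ℝ → ℝ → ℝ} (hstep : TwoLegMomentsStep P R Q₀ Zt Zs u) (hG : G.WF) (hr : Q₀.CR ≤ r)
    (hcc0 : 0 < cc) (hcc : cc ≤ klEngC₃6 P R) (hμ : μ ∈ klWindowC) (h0 : FrameOK R U (nScales β) μ 0) (hU : 0 < U) (hU9 : U ≤ klEngU₀9 P R cc) (hUu : U ≤ u r cc)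
    (hβ : klBetaMin ≤ β) (hβc : β ≤ Real.exp (cc / U ^ 2)) (hL : klEngL₃ β U ≤ L) (hM : klEngM₃ β U L ≤ M) (hR : R.WF2) :
    ∀ n : ℕ, n ≤ nScales β + 1 → HistP klPredsV17F2 L M G P (Q₀.withCR r) R β U μ 0 n → ∀ j ≤ n, TwoLegDualMomentsAt L M Zt Zs β U μ j := by
  intro n
  induction n using Nat.strong_induction_on with
  | _ n ih =>
    intro hn hhist j hj
    rcases hj.lt_or_eq with hlt | rfl
    · exact ih j hlt (by omega) (histP_klPredsV17F2_of_le hhist hlt.le) j le_rfl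
    · exact hstep G hG r hr cc hcc0 hcc μ hμ U hU hU9 hUu β hβ hβc L M hL hM j hn (isKLRegime_of_le_nScales_succ hcc0.le hβ hβc hn)
        hhist (frameOK_klFlowFrameU_of_histP hR h0 hn hhist)
        (fun i hi => ih i hi (by omega) (histP_klPredsV17F2_of_le hhist hi.le) i le_rfl)

/-- **CLASS #7 AT THE DEFERRED PACKAGE, from the producer's existence statement** (`∃ e, IsMomentsPkg e ∧ TwoLegMomentsStep P R Q₀ e.1 e.2.1 e.2.2`):
below the deferred threshold `klC2u P R Q₀ r cc`, the moment line at `(klC2t, klC2s)` at every `j ≤ n`. -/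
theorem twoLegDualMomentsAt_klC2_all_of_exists
    (hex : ∃ e : ℝ × ℝ × (ℝ → ℝ → ℝ), IsMomentsPkg e ∧ TwoLegMomentsStep P R Q₀ e.1 e.2.1 e.2.2)
    (hG : G.WF) (hr : Q₀.CR ≤ r) (hcc0 : 0 < cc) (hcc : cc ≤ klEngC₃6 P R) (hμ : μ ∈ klWindowC) (h0 : FrameOK R U (nScales β) μ 0) (hU : 0 < U) (hU9 : U ≤ klEngU₀9 P R cc)
    (hUu : U ≤ klC2u P R Q₀ r cc) (hβ : klBetaMin ≤ β) (hβc : β ≤ Real.exp (cc / U ^ 2)) (hL : klEngL₃ β U ≤ L) (hM : klEngM₃ β U L ≤ M)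
    (hR : R.WF2) {n : ℕ} (hn : n ≤ nScales β + 1) (hhist : HistP klPredsV17F2 L M G P (Q₀.withCR r) R β U μ 0 n) :
    ∀ j ≤ n, TwoLegDualMomentsAt L M (klC2t P R Q₀) (klC2s P R Q₀) β U μ j :=
  twoLegDualMomentsAt_all_of_step (twoLegMomentsStep_klC2_of_exists P R Q₀ hex) hG hr hcc0 hcc hμ h0 hU hU9 hUu hβ hβc hL hM hR n hn hhist

end Summit.HubbardSuperconductivity.HubbardSuperconductivity.Theorems.EngineV8

end
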